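import Literature.AlgebraicTopology.Homotopy.SphereThreeCoverFibre
import Literature.AlgebraicTopology.Homotopy.SphereConnectedCoverConnectivity
import Literature.Topology.FourManifolds.ComplexProjectiveSpaceCohomology
import Literature.Topology.FourManifolds.ComplexProjectiveSpaceHomologyProofs
import Literature.AlgebraicTopology.SingularHomology.UniversalCoefficientsField
import HarnessLib

/-!
# The `K(ℤ, 2)`-fibre and the cover `S³⟨3⟩` with FIELD coefficients

Topic `Literature/AlgebraicTopology/Homotopy`. Companion of `SphereThreeCoverFibre.lean` (integral
coefficients) for a coefficient FIELD `K` (the case `K = 𝔽ₚ` is the one Serre's method consumes: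
J.-P. Serre, Ann. of Math. 54 (1951), Ch. III §7; A. Hatcher, *Algebraic Topology* (2002),
Example 4.50 / Thm. 3.19: `H*(ℂP^∞; K) = K[x]`, and §4.3 Example 4.72). For the cover
`SphereCover.E (m+2) v → 𝕊ᵐ⁺²` and the fibre `F = SphereCover.Fib 3 v` (`SphereConnectedCover.lean`)
we PROVE (no definitions, no named facts):

* `SphereCover.isZero_singularHomology_E_coeff` — `Hᵢ(Sᵐ⁺²⟨m+2⟩; R) = 0` for `0 < i ≤ m + 2`, any
  commutative ring `R` (Hurewicz vanishing by compression, `isZero_singularHomology_of_cubesContractUpTo`);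
  `SphereCover.isZero_singularCohomology_E_field` — `Hⁱ(Sᵐ⁺²⟨m+2⟩; K) = 0` for `1 ≤ i ≤ m + 2`
  (field universal coefficients `kroneckerPairing_bijective_of_field`);
* `ComplexProjectiveSpace.isZero_singularCohomology_field_of_odd` — `Hⁱ(ℂPᴺ; K) = 0` for `i` odd;
  `ComplexProjectiveSpace.cupPowL_ne_zero` — a non-zero `x ∈ H²(ℂPᴺ; K)` has `xᵏ ≠ 0` for `k ≤ N`
  (Hatcher Thm. 3.19 over a field, from the tree's `cupProduct_ne_zero_of_add_le`);
* `SphereCover.isZero_singularCohomology_fib_three_of_odd_field` — `Hⁱ(F; K) = 0` for `i` odd;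
* **`SphereCover.exists_generator_fib_three_field`** — there is `x ∈ H²(F; K)` with `xʲ ≠ 0` and
  `H²ʲ(F; K) = K · xʲ` for every `j` (comparison `ℂP¹⁺ʲ → F`, `SphereThreeCoverFibre.lean`).

## References

* A. Hatcher, *Algebraic Topology*, CUP (2002), Thm. 3.19, Example 4.50, §4.3 Example 4.72,
  Thm. 4.32, §3.1 Thm. 3.2. [HatcherAT2002]
* J.-P. Serre, Ann. of Math. 54 (1951), Ch. III §7. [Serre1951]
-/

noncomputable section

open Set Metric Function Topology CategoryTheory CategoryTheory.Limits
open scoped unitInterval Topology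
open Literature.AlgebraicTopology.SingularHomology Literature.Topology.FourManifolds

universe w

namespace Literature.Topology.FourManifolds

namespace ComplexProjectiveSpace

variable (K : Type) [Field K]

/-- **`Hⁱ(ℂPᴺ; K) = 0` for `i` odd** (field coefficients): `Hᵢ(ℂPᴺ; K) = 0`
(`singularHomology_complexProjectiveSpace_of_module`) and `Hⁱ ≅ Hom(Hᵢ, K)` over a field.
[cite: HatcherAT2002, Thm. 3.12, §3.1 Thm. 3.2] -/
theorem isZero_singularCohomology_field_of_odd (N : ℕ) {i : ℕ} (hi : ¬ Even i) :
    IsZero (singularCohomology K K (ComplexProjectiveSpace N) i) := by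
  have hz := (singularHomology_complexProjectiveSpace_of_module K K N i).2 (fun h => hi h.1)
  haveI : Subsingleton (singularHomology K K (ComplexProjectiveSpace N) i) := ModuleCat.subsingleton_of_isZero hz
  haveI : Subsingleton (singularCohomology K K (ComplexProjectiveSpace N) i) :=
    (kroneckerPairing_bijective_of_field K (ComplexProjectiveSpace N) i).1.subsingleton
  exact ModuleCat.isZero_of_subsingleton _

/-- **A non-zero degree-two class of `ℂPᴺ` has non-zero powers `xᵏ`, `k ≤ N`** (Hatcher 2002,
Thm. 3.19 over a field: `H*(ℂPᴺ; K) = K[x]/(xᴺ⁺¹)`), from `cupProduct_ne_zero_of_add_le`.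
[cite: HatcherAT2002, Thm. 3.19] -/
theorem cupPowL_ne_zero (N : ℕ) {x : singularCohomology K K (ComplexProjectiveSpace N) 2} (hx : x ≠ 0) :
    ∀ k : ℕ, k ≤ N → cupPowL x k ≠ 0
  | 0, _ => by
    haveI := ComplexProjectiveSpace.pathConnectedSpace N
    rw [cupPowL_zero]
    intro h
    have h1 := congrArg (singularCohomologyZeroEquiv K K (ComplexProjectiveSpace N)) h
    rw [singularCohomologyZeroEquiv_one, map_zero] at h1
    exact one_ne_zero h1
  | k + 1, hk => by
    rw [cupPowL_succ]
    exact cupProduct_ne_zero_of_add_le K N (p := 1) (q := k) (by ring) (by omega) hx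
      (cupPowL_ne_zero N hx k (by omega))

end ComplexProjectiveSpace

end Literature.Topology.FourManifolds

namespace Literature.AlgebraicTopology.Homotopy

namespace SphereCover

/-! ### The cover with arbitrary coefficients -/

/-- **`Hᵢ(Sᵐ⁺²⟨m+2⟩; R) = 0` for `0 < i ≤ m + 2`**, any commutative coefficient ring (Hurewicz
vanishing by compression of singular simplices on the `(m+2)`-connected cover).
[cite: HatcherAT2002, Thm. 4.32, §4.3 Example 4.72] -/
theorem isZero_singularHomology_E_coeff (m : ℕ) (v : Metric.sphere (0 : EuclideanSpace ℝ (Fin (m + 2 + 1))) 1) (R : Type w) [CommRing R] {i : ℕ}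
    (hi0 : 0 < i) (hi : i ≤ m + 2) : IsZero (singularHomology R R (E (m + 2) v) i) := by
  haveI := simplyConnectedSpace_E m v
  obtain ⟨i, rfl⟩ : ∃ i', i = i' + 1 := ⟨i - 1, by omega⟩
  have hc : Compression.CubesContractUpTo (fib₀ (m + 2) v : E (m + 2) v) (i + 1) :=
    cubesContractUpTo_of_subsingleton_homotopyGroup ((fib₀ (m + 2) v : E (m + 2) v)) (i + 1)
      fun k hk hki => subsingleton_homotopyGroup_E m v (k := k) (by omega) (by omega) _
  exact isZero_singularHomology_of_cubesContractUpTo hc R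

/-- **`Hⁱ(Sᵐ⁺²⟨m+2⟩; K) = 0` for `1 ≤ i ≤ m + 2`** over a field (`Hⁱ ≅ Hom(Hᵢ, K)`).
[cite: HatcherAT2002, §3.1 Thm. 3.2, Thm. 4.32] -/
theorem isZero_singularCohomology_E_field (m : ℕ) (v : Metric.sphere (0 : EuclideanSpace ℝ (Fin (m + 2 + 1))) 1) (K : Type) [Field K] {i : ℕ}
    (hi1 : 1 ≤ i) (hi : i ≤ m + 2) : IsZero (singularCohomology K K (E (m + 2) v) i) := by
  haveI : Subsingleton (singularHomology K K (E (m + 2) v) i) :=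
    ModuleCat.subsingleton_of_isZero (isZero_singularHomology_E_coeff m v K hi1 hi)
  haveI : Subsingleton (singularCohomology K K (E (m + 2) v) i) :=
    (kroneckerPairing_bijective_of_field K (E (m + 2) v) i).1.subsingleton
  exact ModuleCat.isZero_of_subsingleton _

/-! ### The fibre with field coefficients -/

variable (v : Metric.sphere (0 : EuclideanSpace ℝ (Fin (3 + 1))) 1) (K : Type) [Field K]

/-- **`Hⁱ(F; K) = 0` for `i` odd** (`F` the `K(ℤ,2)`-fibre of `S³⟨3⟩ → S³`, field `K`).
[cite: HatcherAT2002, Thm. 3.19, Example 4.50] -/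
theorem isZero_singularCohomology_fib_three_of_odd_field {i : ℕ} (hi : ¬ Even i) :
    IsZero (singularCohomology K K (Fib 3 v) i) := by
  obtain ⟨c, -, -, hc, -⟩ := exists_comparison_fib_three.{0} v i
  haveI := hc K K i (by omega)
  exact (ComplexProjectiveSpace.isZero_singularCohomology_field_of_odd K (1 + i) hi).of_iso
    (asIso (singularCohomology.map K K c i))

/-- `H²(F; K)` is non-trivial: it contains a non-zero class (comparison with `H²(ℂP¹; K) ≅ K`).
[cite: HatcherAT2002, Thm. 3.19, Example 4.50] -/
theorem exists_ne_zero_fib_three_field : ∃ x : singularCohomology K K (Fib 3 v) 2, x ≠ 0 := by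
  obtain ⟨c, -, -, hc, -⟩ := exists_comparison_fib_three.{0} v 0
  haveI := hc K K 2 (by omega)
  let e := (asIso (singularCohomology.map K K c 2)).toLinearEquiv
  have hfin : Module.finrank K (singularCohomology K K (ComplexProjectiveSpace (1 + 0)) (2 * 1)) = 1 :=
    ComplexProjectiveSpace.finrank_singularCohomology_two_mul_eq_one K (1 + 0) 1 (by omega)
  obtain ⟨y, hy⟩ : ∃ y : singularCohomology K K (ComplexProjectiveSpace (1 + 0)) 2, y ≠ 0 := by
    by_contra! h
    haveI : Subsingleton (singularCohomology K K (ComplexProjectiveSpace (1 + 0)) (2 * 1)) :=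
      ⟨fun a b => by rw [h a, h b]⟩
    rw [Module.finrank_zero_of_subsingleton] at hfin
    exact zero_ne_one hfin
  exact ⟨e.symm y, fun h => hy (by rw [← e.apply_symm_apply y, h, map_zero])⟩

/-- **`H*(F; K) = K[x]` in the needed form**: there is `x ∈ H²(F; K)` such that for every `j` the
power `xʲ = cupPowL x j` is non-zero and spans `H²ʲ(F; K)` (`F` the `K(ℤ,2)`-fibre of `S³⟨3⟩ → S³`,
field `K`; transport from `ℂP¹⁺ʲ` along the multiplicative isomorphisms `c^*`).
[cite: HatcherAT2002, Thm. 3.19, Example 4.50] -/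
theorem exists_generator_fib_three_field :
    ∃ x : singularCohomology K K (Fib 3 v) 2, ∀ j : ℕ,
      cupPowL x j ≠ 0 ∧ ∀ z : singularCohomology K K (Fib 3 v) (2 * j), ∃ a : K, z = a • cupPowL x j := by
  obtain ⟨x, hx⟩ := exists_ne_zero_fib_three_field v K
  refine ⟨x, fun j => ?_⟩
  obtain ⟨c, -, -, hc, -⟩ := exists_comparison_fib_three.{0} v j
  haveI h2 := hc K K 2 (by omega)
  haveI h2j := hc K K (2 * j) (by omega)
  have hinj2 : Injective (singularCohomology.map K K c 2) :=
    (ConcreteCategory.bijective_of_isIso (singularCohomology.map K K c 2)).1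
  have hbij : Bijective (singularCohomology.map K K c (2 * j)) :=
    ConcreteCategory.bijective_of_isIso (singularCohomology.map K K c (2 * j))
  -- `c^* x ≠ 0`, hence `(c^* x)ʲ = c^* (xʲ) ≠ 0`
  have hx' : singularCohomology.map K K c 2 x ≠ 0 := fun h => hx (hinj2 (by rw [h, map_zero]))
  have hpow' := ComplexProjectiveSpace.cupPowL_ne_zero K (1 + j) hx' j (by omega)
  rw [← map_cupPowL] at hpow'
  refine ⟨fun h => hpow' (by rw [h, map_zero]), fun z => ?_⟩
  obtain ⟨a, ha⟩ := ComplexProjectiveSpace.exists_eq_smul_of_ne_zero K (N := 1 + j) (k := j) (by omega)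
    (β := singularCohomology.map K K c (2 * j) (cupPowL x j)) hpow' (singularCohomology.map K K c (2 * j) z)
  refine ⟨a, hbij.1 ?_⟩
  rw [ha, LinearMap.map_smul]

end SphereCover

end Literature.AlgebraicTopology.Homotopy

end
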